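import Summits.PneNP.PneNP.Theorems.ChebyshevTracialDesignRungCorollaries
import Summits.PneNP.PneNP.Theorems.ChebyshevTracialDesignFiniteValued
import HarnessLib

/-!
# Cell pnp-psdrank, route `ChebyshevTracialDesign`: the DICTIONARY LEMMA — a tight psd strategy whose cut (or matching) side
# is diagonal in a dictionary of `L` directions is worth at most `L` tight-free rectangles (crux `TracialDecayExp20`, stmt-PneNP-19878)

Brick 34 (prover g9). For the crux one bounds the value `Σ_{U,M} W(U,M) tr(X_U Y_M)` of a design weight `W` on tight-orthogonal psd
rectangles `(X, Y)` of dimension `r` (`IsPsdRect`: `0 ⪯ X_U, Y_M ⪯ I`, `X_U Y_M = 0` when `cc(U,M) = 1`). The tree has the bound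
`value ≤ r·γ` (γ = the best tight-free 0/1 rectangle, `TracialValueLEAt W γ 1`) for COMMUTATIVE strategies (`…Commutative`, common
eigenbasis on BOTH sides) and the tightness-FREE bound `value ≤ r·|ι|·(best 0/1 rectangle)` for `|ι|`-valued cut sides (`…FiniteValued`,
eng g10), for which no decay theorem exists. This file proves the common generalisation that KEEPS TIGHTNESS:

* §1 (generic) DICTIONARY LEMMA `sum_trace_le_of_dictionary`: if `X_a = Σ_{d ∈ ι} λ_a(d)·v_d v_dᵀ` (`0 ≤ λ ≤ 1`, `‖v_d‖ ≤ 1`) over a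
  dictionary of `|ι| = L` directions (not orthogonal; the `X_a` need not commute), the `Y_b` are arbitrary contractions and `tr(X_a Y_b) = 0`
  on the forbidden pairs, then `Σ W(a,b) tr(X_a Y_b) ≤ L·γ`: `tr(X_a Y_b) = Σ_d λ_a(d)·(v_dᵀ Y_b v_d)` splits the value into `L` FRACTIONAL
  forbidden-pair-free rectangles (a vanishing sum of nonnegative terms vanishes termwise), each `≤` a 0/1 one (`sum_box_le_rectangle`);
  and the FINITE-VALUED LEMMA WITH TIGHTNESS `sum_trace_le_of_finiteValued`: `X_a = P_{κ(a)}` with `|ι|` values ⇒ `≤ r·|ι|·γ`, γ the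
  TIGHT-FREE rectangle bound — eng's `value_le_card_mul_of_rectangleBound` with tightness restored;
* §2 the matching-slack instances on either side (`value_le_of_cutDictionary`, `value_le_of_matchingDictionary`,
  `value_div_le_of_cutFiniteValued`, `value_div_le_of_matchingFiniteValued`) and the ONE-SIDED EIGENBASIS theorem
  `value_div_le_of_cutEigenbasis`: if only the CUT side has a common orthonormal eigenbasis (`X_U = O·diag(x_U)·Oᵀ`), the matching side
  being ARBITRARY, then already `value/r ≤ γ` — strictly generalising `…Commutative.value_div_le_of_commonEigenbasis`;
* §3 in the crux's currency modulo Keevash–Lifshitz Thm 1.8 (`GlobalLevelDInequality`, via the `r = 1` rung `rectangleDecayExp_of_globalLevelD`):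
  for some `a > 0` and all large even `n`, every balanced `B = 20` design has normalised value `≤ exp(−a·dq n)` on every tight psd rectangle of
  ANY dimension `r ≥ 1` whose cut side is diagonal in a dictionary of `≤ r·exp(a·dq n)` directions (`tracialDecayExp_cutDictionary_of_globalLevelD`),
  or takes `≤ exp(a·dq n)` values (`…_cutFiniteValued_…`), or has a common eigenbasis (`…_cutEigenbasis_…`, rung rate, no budget).

Reading: per dimension, a tight psd strategy beats tight-free rectangles only through DIRECTIONAL ENTROPY `log(L/r) > a·dq n` of a side;
the crux's dimension budget is idle on these classes. [cite: Rothvoss2017, §2 (PDF pp. 6–8)] [cite: BrietDadushPokutta2014, Thm. 6 (§3)]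
[cite: KeevashLifshitz2023, Thm. 1.8] Stature: support/instrument (§3 CONDITIONAL on `GlobalLevelDInequality`). WHAT THIS IS NOT: not the
crux (a general family of `C(n,t)` projections needs up to `r·C(n,t)` directions), nothing on psd rank of P_PM, no P-vs-NP content.
-/

set_option linter.dupNamespace false -- `Summit.PneNP.PneNP.…`: summit = sub-problem (D-0017)

noncomputable section

namespace Summit.PneNP.PneNP.Theorems.ChebyshevTracialDesignDictionary

open scoped Classical

open Finset Matrix Literature.Barriers.PneNP Literature.Combinatorics.Optimization
open Literature.Combinatorics.Additive.KeevashLifshitz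
open Summit.PneNP.PneNP.Theorems.ChebyshevTracialDesignDimensionOne (sum_box_le_rectangle tracialValueLEAt_one_iff)
open Summit.PneNP.PneNP.Theorems.ChebyshevTracialDesignCommutative (posSemidef_conj)
open Summit.PneNP.PneNP.Theorems.ChebyshevTracialDesignFiniteValued (trace_mul_le_card)
open Summit.PneNP.PneNP.Theorems.ChebyshevTracialDesignRungAssembly (rectangleDecayExp_of_globalLevelD)

/-! ### §0 Quadratic forms of contractions -/

/-- `tr(v wᵀ · Y) = v ⬝ (w ᵥ* Y)`. -/
theorem trace_vecMulVec_mul {r : ℕ} (v w : Fin r → ℝ) (Y : Matrix (Fin r) (Fin r) ℝ) :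
    (vecMulVec v w * Y).trace = v ⬝ᵥ (w ᵥ* Y) := by
  simp only [trace, diag_apply, mul_apply, vecMulVec_apply, dotProduct, vecMul, Finset.mul_sum]
  refine sum_congr rfl fun i _ => sum_congr rfl fun j _ => ?_
  ring

/-- For a real symmetric `Y`: `tr(v vᵀ · Y) = v ⬝ (Y v)`. -/
theorem trace_vecMulVec_mul_of_isHermitian {r : ℕ} (v : Fin r → ℝ) {Y : Matrix (Fin r) (Fin r) ℝ} (hY : Y.IsHermitian) :
    (vecMulVec v v * Y).trace = v ⬝ᵥ (Y *ᵥ v) := by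
  rw [trace_vecMulVec_mul, ← mulVec_transpose]
  have hYt : Yᵀ = Y := by
    have h := hY.eq
    rwa [conjTranspose_eq_transpose_of_trivial] at h
  rw [hYt]

/-- `0 ≤ v ⬝ (Y v)` for `Y ⪰ 0` (real case of `PosSemidef.dotProduct_mulVec_nonneg`). -/
theorem quadForm_nonneg {r : ℕ} {Y : Matrix (Fin r) (Fin r) ℝ} (hY : Y.PosSemidef) (v : Fin r → ℝ) :
    0 ≤ v ⬝ᵥ (Y *ᵥ v) := by
  have h := hY.dotProduct_mulVec_nonneg v
  rwa [star_trivial] at h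

/-- `v ⬝ (Y v) ≤ v ⬝ v` for `Y ⪯ I`. -/
theorem quadForm_le_self {r : ℕ} {Y : Matrix (Fin r) (Fin r) ℝ} (h1Y : (1 - Y).PosSemidef) (v : Fin r → ℝ) :
    v ⬝ᵥ (Y *ᵥ v) ≤ v ⬝ᵥ v := by
  have h := quadForm_nonneg h1Y v
  rw [sub_mulVec, one_mulVec, dotProduct_sub] at h
  linarith

/-- `tr((Σ_d λ_d · v_d v_dᵀ) · Y) = Σ_d λ_d · (v_d ⬝ Y v_d)` for symmetric `Y`. -/
theorem trace_dictionary_mul {r : ℕ} {ι : Type*} [Fintype ι] (lam : ι → ℝ) (v : ι → Fin r → ℝ)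
    {Y : Matrix (Fin r) (Fin r) ℝ} (hY : Y.IsHermitian) :
    ((∑ d, lam d • vecMulVec (v d) (v d)) * Y).trace = ∑ d, lam d * (v d ⬝ᵥ (Y *ᵥ v d)) := by
  rw [sum_mul, trace_sum]
  refine sum_congr rfl fun d _ => ?_
  rw [smul_mul_assoc, trace_smul, smul_eq_mul, trace_vecMulVec_mul_of_isHermitian _ hY]

/-! ### §1 Generic dictionary and finite-valued lemmas (any two finite index types, any forbidden relation) -/

section Generic

variable {α β : Type} [Fintype α] [Fintype β]

/-- **Dictionary lemma (generic).** Let `W : α → β → ℝ`, `T` a forbidden relation, and suppose every `T`-free 0/1 rectangle has `W`-mass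
`≤ γ`. If `X_a = Σ_{d ∈ ι} λ_a(d)·v_d v_dᵀ` (`0 ≤ λ ≤ 1`, `‖v_d‖² ≤ 1`), every `Y_b` is a contraction and `tr(X_a Y_b) = 0` on `T`, then
`Σ_{a,b} W(a,b) tr(X_a Y_b) ≤ |ι|·γ`. [cite: Rothvoss2017, §2 (PDF pp. 6–8)] -/
theorem sum_trace_le_of_dictionary {r : ℕ} {ι : Type*} [Fintype ι] (W : α → β → ℝ) (T : α → β → Prop) (γ : ℝ)
    (hrect : ∀ (A : Finset α) (B : Finset β), (∀ a ∈ A, ∀ b ∈ B, ¬ T a b) → ∑ a ∈ A, ∑ b ∈ B, W a b ≤ γ)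
    (v : ι → Fin r → ℝ) (hv : ∀ d, v d ⬝ᵥ v d ≤ 1) (lam : α → ι → ℝ) (hlam : ∀ a d, 0 ≤ lam a d ∧ lam a d ≤ 1)
    (X : α → Matrix (Fin r) (Fin r) ℝ) (Y : β → Matrix (Fin r) (Fin r) ℝ)
    (hX : ∀ a, X a = ∑ d, lam a d • vecMulVec (v d) (v d)) (hY : ∀ b, (Y b).PosSemidef ∧ (1 - Y b).PosSemidef)
    (hT : ∀ a b, T a b → (X a * Y b).trace = 0) :
    ∑ a, ∑ b, W a b * (X a * Y b).trace ≤ Fintype.card ι * γ := by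
  set q : ι → β → ℝ := fun d b => v d ⬝ᵥ (Y b *ᵥ v d) with hq
  have hq01 : ∀ d b, 0 ≤ q d b ∧ q d b ≤ 1 := fun d b =>
    ⟨quadForm_nonneg (hY b).1 _, (quadForm_le_self (hY b).2 _).trans (hv d)⟩
  have htr : ∀ a b, (X a * Y b).trace = ∑ d, lam a d * q d b := fun a b => by
    rw [hX a, trace_dictionary_mul _ _ (hY b).1.1]
  have hTd : ∀ d a b, T a b → lam a d * q d b = 0 := fun d a b hab => by
    have h0 : ∑ d, lam a d * q d b = 0 := by rw [← htr]; exact hT a b hab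
    exact (sum_eq_zero_iff_of_nonneg fun d _ => mul_nonneg (hlam a d).1 (hq01 d b).1).1 h0 d (mem_univ d)
  have hsplit : ∑ a, ∑ b, W a b * (X a * Y b).trace = ∑ d, ∑ a, ∑ b, W a b * (lam a d * q d b) := by
    calc ∑ a, ∑ b, W a b * (X a * Y b).trace = ∑ a, ∑ b, ∑ d, W a b * (lam a d * q d b) :=
          sum_congr rfl fun a _ => sum_congr rfl fun b _ => by rw [htr, mul_sum]
      _ = ∑ a, ∑ d, ∑ b, W a b * (lam a d * q d b) := sum_congr rfl fun a _ => sum_comm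
      _ = ∑ d, ∑ a, ∑ b, W a b * (lam a d * q d b) := sum_comm
  rw [hsplit]
  calc ∑ d, ∑ a, ∑ b, W a b * (lam a d * q d b) ≤ ∑ _d : ι, γ := sum_le_sum fun d _ => by
        obtain ⟨A, B, hAB, hle⟩ := sum_box_le_rectangle W T (fun a => lam a d) (q d)
          (fun a => hlam a d) (hq01 d) (fun a b hab => hTd d a b hab)
        exact hle.trans (hrect A B hAB)
    _ = Fintype.card ι * γ := by rw [sum_const, card_univ, nsmul_eq_mul]

/-- **Finite-valued lemma with tightness (generic).** If every `T`-free 0/1 rectangle has `W`-mass `≤ γ`, `X_a = P_{κ(a)}` for a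
colouring `κ : α → ι` and contractions `P_c`, every `Y_b` is a contraction and `tr(X_a Y_b) = 0` on `T`, then
`Σ_{a,b} W(a,b) tr(X_a Y_b) ≤ r·|ι|·γ`. [cite: Rothvoss2017, §2 (PDF pp. 6–8)] -/
theorem sum_trace_le_of_finiteValued {r : ℕ} {ι : Type*} [Fintype ι] (W : α → β → ℝ) (T : α → β → Prop) (γ : ℝ)
    (hrect : ∀ (A : Finset α) (B : Finset β), (∀ a ∈ A, ∀ b ∈ B, ¬ T a b) → ∑ a ∈ A, ∑ b ∈ B, W a b ≤ γ)
    (κ : α → ι) (P : ι → Matrix (Fin r) (Fin r) ℝ) (hP : ∀ c, (P c).PosSemidef ∧ (1 - P c).PosSemidef)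
    (Y : β → Matrix (Fin r) (Fin r) ℝ) (hY : ∀ b, (Y b).PosSemidef ∧ (1 - Y b).PosSemidef)
    (hT : ∀ a b, T a b → (P (κ a) * Y b).trace = 0) :
    ∑ a, ∑ b, W a b * (P (κ a) * Y b).trace ≤ (r : ℝ) * (Fintype.card ι * γ) := by
  rcases Nat.eq_zero_or_pos r with rfl | hr
  · have : ∀ a b, (P (κ a) * Y b).trace = 0 := fun a b => by simp [trace]
    simp only [this, mul_zero, sum_const_zero, Nat.cast_zero, zero_mul, le_refl]
  have hr' : (0 : ℝ) < r := by exact_mod_cast hr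
  -- colour-`c` fractional rectangle: `x_c = 1[κ = c]`, `y_c(b) = tr(P_c Y_b)/r ∈ [0,1]`
  set y : ι → β → ℝ := fun c b => (P c * Y b).trace / r with hy
  have hy01 : ∀ c b, 0 ≤ y c b ∧ y c b ≤ 1 := fun c b => by
    refine ⟨div_nonneg ?_ hr'.le, (div_le_one hr').2 (trace_mul_le_card (hP c).2 (hY b).1 (hY b).2)⟩
    exact (show HasPsdFactorization (fun (_ : Unit) (_ : Unit) => (P c * Y b).trace) r from
      ⟨fun _ => P c, fun _ => Y b, fun _ => (hP c).1, fun _ => (hY b).1, fun _ _ => rfl⟩).nonneg () ()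
  set x : ι → α → ℝ := fun c a => if κ a = c then 1 else 0 with hx
  have hx01 : ∀ c a, 0 ≤ x c a ∧ x c a ≤ 1 := fun c a => by rw [hx]; dsimp only; split_ifs <;> norm_num
  have hTc : ∀ c a b, T a b → x c a * y c b = 0 := fun c a b hab => by
    rw [hx, hy]; dsimp only; split_ifs with hc
    · rw [← hc, hT a b hab, zero_div, mul_zero]
    · rw [zero_mul]
  have hsplit : ∑ a, ∑ b, W a b * (P (κ a) * Y b).trace = ∑ c, (r : ℝ) * ∑ a, ∑ b, W a b * (x c a * y c b) := by
    have hterm : ∀ a b, W a b * (P (κ a) * Y b).trace = ∑ c, (r : ℝ) * (W a b * (x c a * y c b)) := fun a b => by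
      rw [hx, hy]; dsimp only
      rw [sum_eq_single (κ a) (fun c _ hc => by rw [if_neg (Ne.symm hc), zero_mul, mul_zero, mul_zero])
        (fun h => absurd (mem_univ _) h), if_pos rfl, one_mul]
      field_simp
    calc ∑ a, ∑ b, W a b * (P (κ a) * Y b).trace = ∑ a, ∑ b, ∑ c, (r : ℝ) * (W a b * (x c a * y c b)) :=
          sum_congr rfl fun a _ => sum_congr rfl fun b _ => hterm a b
      _ = ∑ a, ∑ c, ∑ b, (r : ℝ) * (W a b * (x c a * y c b)) := sum_congr rfl fun a _ => sum_comm
      _ = ∑ c, ∑ a, ∑ b, (r : ℝ) * (W a b * (x c a * y c b)) := sum_comm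
      _ = ∑ c, (r : ℝ) * ∑ a, ∑ b, W a b * (x c a * y c b) := sum_congr rfl fun c _ => by
          rw [mul_sum]; exact sum_congr rfl fun a _ => by rw [mul_sum]
  rw [hsplit]
  calc ∑ c, (r : ℝ) * ∑ a, ∑ b, W a b * (x c a * y c b) ≤ ∑ _c : ι, (r : ℝ) * γ :=
        sum_le_sum fun c _ => mul_le_mul_of_nonneg_left (by
          obtain ⟨A, B, hAB, hle⟩ := sum_box_le_rectangle W T (x c) (y c) (hx01 c) (hy01 c) (hTc c)
          exact hle.trans (hrect A B hAB)) hr'.le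
    _ = (r : ℝ) * (Fintype.card ι * γ) := by rw [sum_const, card_univ, nsmul_eq_mul]; ring

end Generic

/-! ### §2 The matching-slack instances: cut side, matching side, one-sided eigenbasis -/

variable {n : ℕ}

/-- The tight-free rectangle bound, read from `TracialValueLEAt W γ 1`, in the transposed order (matchings first). -/
theorem rect_bound_transpose (W : OddSet n → PMatch n → ℝ) (γ : ℝ) (h1 : TracialValueLEAt W γ 1)
    (A : Finset (PMatch n)) (B : Finset (OddSet n)) (hAB : ∀ M ∈ A, ∀ U ∈ B, ¬ cc U M = 1) :
    ∑ M ∈ A, ∑ U ∈ B, W U M ≤ γ := by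
  rw [sum_comm]
  exact (tracialValueLEAt_one_iff W γ).1 h1 B A fun U hU M hM => hAB M hM U hU

/-- **Cut-side dictionary.** `TracialValueLEAt W γ 1`, `X_U = Σ_d λ_U(d)·v_d v_dᵀ` over a dictionary `ι` (`0 ≤ λ ≤ 1`, `‖v_d‖² ≤ 1`),
`Y_M` contractions, `tr(X_U Y_M) = 0` on the tight pairs ⇒ `Σ W tr(X_U Y_M) ≤ |ι|·γ`. [cite: Rothvoss2017, §2 (PDF pp. 6–8)] -/
theorem value_le_of_cutDictionary {r : ℕ} {ι : Type*} [Fintype ι] (W : OddSet n → PMatch n → ℝ) (γ : ℝ)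
    (h1 : TracialValueLEAt W γ 1) (v : ι → Fin r → ℝ) (hv : ∀ d, v d ⬝ᵥ v d ≤ 1)
    (lam : OddSet n → ι → ℝ) (hlam : ∀ U d, 0 ≤ lam U d ∧ lam U d ≤ 1)
    (X : OddSet n → Matrix (Fin r) (Fin r) ℝ) (Y : PMatch n → Matrix (Fin r) (Fin r) ℝ)
    (hX : ∀ U, X U = ∑ d, lam U d • vecMulVec (v d) (v d)) (hY : ∀ M, (Y M).PosSemidef ∧ (1 - Y M).PosSemidef)
    (hT : ∀ U M, cc U M = 1 → (X U * Y M).trace = 0) :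
    ∑ U, ∑ M, W U M * (X U * Y M).trace ≤ Fintype.card ι * γ :=
  sum_trace_le_of_dictionary W (fun U M => cc U M = 1) γ ((tracialValueLEAt_one_iff W γ).1 h1) v hv lam hlam X Y hX hY hT

/-- **Matching-side dictionary.** The same with the roles exchanged: `Y_M = Σ_d θ_M(d)·v_d v_dᵀ`, `X_U` contractions.
[cite: Rothvoss2017, §2 (PDF pp. 6–8)] -/
theorem value_le_of_matchingDictionary {r : ℕ} {ι : Type*} [Fintype ι] (W : OddSet n → PMatch n → ℝ) (γ : ℝ)
    (h1 : TracialValueLEAt W γ 1) (v : ι → Fin r → ℝ) (hv : ∀ d, v d ⬝ᵥ v d ≤ 1)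
    (θ : PMatch n → ι → ℝ) (hθ : ∀ M d, 0 ≤ θ M d ∧ θ M d ≤ 1)
    (X : OddSet n → Matrix (Fin r) (Fin r) ℝ) (Y : PMatch n → Matrix (Fin r) (Fin r) ℝ)
    (hX : ∀ U, (X U).PosSemidef ∧ (1 - X U).PosSemidef) (hY : ∀ M, Y M = ∑ d, θ M d • vecMulVec (v d) (v d))
    (hT : ∀ U M, cc U M = 1 → (X U * Y M).trace = 0) :
    ∑ U, ∑ M, W U M * (X U * Y M).trace ≤ Fintype.card ι * γ := by
  have h := sum_trace_le_of_dictionary (fun M U => W U M) (fun M U => cc U M = 1) γ (rect_bound_transpose W γ h1)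
    v hv θ hθ Y X hY hX (fun M U hUM => by rw [trace_mul_comm]; exact hT U M hUM)
  rw [sum_comm]
  calc ∑ M, ∑ U, W U M * (X U * Y M).trace = ∑ M, ∑ U, W U M * (Y M * X U).trace :=
        sum_congr rfl fun M _ => sum_congr rfl fun U _ => by rw [trace_mul_comm]
    _ ≤ Fintype.card ι * γ := h

/-- **Cut side with finitely many values, tightness kept.** For a tight-orthogonal psd rectangle `(X, Y)` of dimension `r ≥ 1` with
`X = P ∘ κ` for a colouring `κ` by a finite type `ι`, and `TracialValueLEAt W γ 1` (tight-free rectangles only):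
`value/r ≤ |ι|·γ`. [cite: Rothvoss2017, §2 (PDF pp. 6–8)] [cite: GriblingDelaatLaurent2019, §5] -/
theorem value_div_le_of_cutFiniteValued {r : ℕ} (hr : 0 < r) {ι : Type*} [Fintype ι] (W : OddSet n → PMatch n → ℝ) (γ : ℝ)
    (h1 : TracialValueLEAt W γ 1) (κ : OddSet n → ι) (P : ι → Matrix (Fin r) (Fin r) ℝ)
    {X : OddSet n → Matrix (Fin r) (Fin r) ℝ} {Y : PMatch n → Matrix (Fin r) (Fin r) ℝ} (hXY : IsPsdRect X Y)
    (hX : ∀ U, X U = P (κ U)) :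
    (∑ U, ∑ M, W U M * (X U * Y M).trace) / r ≤ Fintype.card ι * γ := by
  have hr' : (0 : ℝ) < r := by exact_mod_cast hr
  -- palette restricted to the colours actually used (unused colours get the contraction `0`)
  set P' : ι → Matrix (Fin r) (Fin r) ℝ := fun c => if ∃ U, κ U = c then P c else 0 with hP'def
  have hXP' : ∀ U, X U = P' (κ U) := fun U => by rw [hP'def]; dsimp only; rw [if_pos ⟨U, rfl⟩]; exact hX U
  have hP' : ∀ c, (P' c).PosSemidef ∧ (1 - P' c).PosSemidef := by
    intro c
    by_cases hc : ∃ U, κ U = c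
    · obtain ⟨U, rfl⟩ := hc
      rw [← hXP' U]
      exact hXY.1 U
    · rw [hP'def]; dsimp only; rw [if_neg hc, sub_zero]
      exact ⟨Matrix.PosSemidef.zero, Matrix.PosSemidef.one⟩
  have hT : ∀ U M, cc U M = 1 → (P' (κ U) * Y M).trace = 0 := fun U M hUM => by
    rw [← hXP' U, hXY.2.2 U M hUM, trace_zero]
  have h := sum_trace_le_of_finiteValued W (fun U M => cc U M = 1) γ ((tracialValueLEAt_one_iff W γ).1 h1) κ P' hP' Y
    (fun M => hXY.2.1 M) hT
  have hrw : ∑ U, ∑ M, W U M * (X U * Y M).trace = ∑ U, ∑ M, W U M * (P' (κ U) * Y M).trace :=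
    sum_congr rfl fun U _ => by rw [hXP' U]
  rw [hrw, div_le_iff₀ hr']
  calc ∑ U, ∑ M, W U M * (P' (κ U) * Y M).trace ≤ (r : ℝ) * (Fintype.card ι * γ) := h
    _ = Fintype.card ι * γ * r := by ring

/-- **Matching side with finitely many values, tightness kept**: `Y = Q ∘ κ` for a colouring `κ : PMatch n → ι` ⇒ `value/r ≤ |ι|·γ`.
[cite: Rothvoss2017, §2 (PDF pp. 6–8)] [cite: GriblingDelaatLaurent2019, §5] -/
theorem value_div_le_of_matchingFiniteValued {r : ℕ} (hr : 0 < r) {ι : Type*} [Fintype ι] (W : OddSet n → PMatch n → ℝ)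
    (γ : ℝ) (h1 : TracialValueLEAt W γ 1) (κ : PMatch n → ι) (Q : ι → Matrix (Fin r) (Fin r) ℝ)
    {X : OddSet n → Matrix (Fin r) (Fin r) ℝ} {Y : PMatch n → Matrix (Fin r) (Fin r) ℝ} (hXY : IsPsdRect X Y)
    (hYQ : ∀ M, Y M = Q (κ M)) :
    (∑ U, ∑ M, W U M * (X U * Y M).trace) / r ≤ Fintype.card ι * γ := by
  have hr' : (0 : ℝ) < r := by exact_mod_cast hr
  set Q' : ι → Matrix (Fin r) (Fin r) ℝ := fun c => if ∃ M, κ M = c then Q c else 0 with hQ'def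
  have hYQ' : ∀ M, Y M = Q' (κ M) := fun M => by rw [hQ'def]; dsimp only; rw [if_pos ⟨M, rfl⟩]; exact hYQ M
  have hQ' : ∀ c, (Q' c).PosSemidef ∧ (1 - Q' c).PosSemidef := by
    intro c
    by_cases hc : ∃ M, κ M = c
    · obtain ⟨M, rfl⟩ := hc
      rw [← hYQ' M]
      exact hXY.2.1 M
    · rw [hQ'def]; dsimp only; rw [if_neg hc, sub_zero]
      exact ⟨Matrix.PosSemidef.zero, Matrix.PosSemidef.one⟩
  have hT : ∀ M U, cc U M = 1 → (Q' (κ M) * X U).trace = 0 := fun M U hUM => by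
    rw [← hYQ' M, trace_mul_comm, hXY.2.2 U M hUM, trace_zero]
  have h := sum_trace_le_of_finiteValued (fun M U => W U M) (fun M U => cc U M = 1) γ (rect_bound_transpose W γ h1)
    κ Q' hQ' X (fun U => hXY.1 U) hT
  have hrw : ∑ U, ∑ M, W U M * (X U * Y M).trace = ∑ M, ∑ U, W U M * (Q' (κ M) * X U).trace := by
    rw [sum_comm]
    exact sum_congr rfl fun M _ => sum_congr rfl fun U _ => by rw [hYQ' M, trace_mul_comm]
  rw [hrw, div_le_iff₀ hr']
  calc ∑ M, ∑ U, W U M * (Q' (κ M) * X U).trace ≤ (r : ℝ) * (Fintype.card ι * γ) := h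
    _ = Fintype.card ι * γ * r := by ring

/-- `O·diag(x)·Oᵀ = Σ_d x_d · (O e_d)(O e_d)ᵀ`: a matrix diagonal in the orthonormal basis of the columns of `O` is a dictionary
combination over those columns. -/
theorem conj_diagonal_eq_sum_vecMulVec {r : ℕ} (O : Matrix (Fin r) (Fin r) ℝ) (x : Fin r → ℝ) :
    O * diagonal x * Oᵀ = ∑ d, x d • vecMulVec (fun i => O i d) (fun i => O i d) := by
  ext i j
  rw [Matrix.sum_apply, mul_apply]
  refine sum_congr rfl fun d _ => ?_
  rw [mul_diagonal, transpose_apply, Matrix.smul_apply, vecMulVec_apply, smul_eq_mul]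
  ring

/-- **One-sided eigenbasis.** If the CUT side of a tight-orthogonal psd rectangle of dimension `r ≥ 1` has a common orthonormal eigenbasis,
`X_U = O·diag(x_U)·Oᵀ` with `OᵀO = I` — the matching side `Y` being ARBITRARY (`IsPsdRect X Y` only) — then `TracialValueLEAt W γ 1`
gives `value/r ≤ γ`. Strictly generalises `…Commutative.value_div_le_of_commonEigenbasis` (both sides diagonal in `O`).
[cite: Rothvoss2017, §2 (PDF pp. 6–7)] [cite: BrietDadushPokutta2014, Thm. 6 (§3)] -/
theorem value_div_le_of_cutEigenbasis {r : ℕ} (hr : 0 < r) (W : OddSet n → PMatch n → ℝ) (γ : ℝ)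
    (h1 : TracialValueLEAt W γ 1) (O : Matrix (Fin r) (Fin r) ℝ) (hO : Oᵀ * O = 1) (x : OddSet n → Fin r → ℝ)
    {X : OddSet n → Matrix (Fin r) (Fin r) ℝ} {Y : PMatch n → Matrix (Fin r) (Fin r) ℝ}
    (hX : ∀ U, X U = O * diagonal (x U) * Oᵀ) (h : IsPsdRect X Y) :
    (∑ U, ∑ M, W U M * (X U * Y M).trace) / r ≤ γ := by
  have hr' : (0 : ℝ) < r := by exact_mod_cast hr
  -- the entries `x_U(d)` lie in `[0,1]`: conjugate `0 ⪯ X_U ⪯ I` back to the diagonal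
  have hOXO : ∀ U, Oᵀ * X U * (Oᵀ)ᵀ = diagonal (x U) := fun U => by
    rw [hX U, transpose_transpose]
    calc Oᵀ * (O * diagonal (x U) * Oᵀ) * O = (Oᵀ * O) * diagonal (x U) * (Oᵀ * O) := by
          simp only [Matrix.mul_assoc]
      _ = diagonal (x U) := by rw [hO, Matrix.one_mul, Matrix.mul_one]
  have hx01 : ∀ U d, 0 ≤ x U d ∧ x U d ≤ 1 := fun U d => by
    have hpsd : (diagonal (x U)).PosSemidef := by rw [← hOXO U]; exact posSemidef_conj (h.1 U).1 Oᵀ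
    have hpsd1 : (diagonal fun i => 1 - x U i).PosSemidef := by
      have e : Oᵀ * (1 - X U) * (Oᵀ)ᵀ = diagonal fun i => 1 - x U i := by
        rw [Matrix.mul_sub, Matrix.sub_mul, hOXO U, transpose_transpose, Matrix.mul_one, hO, ← diagonal_one,
          diagonal_sub]
      rw [← e]; exact posSemidef_conj (h.1 U).2 Oᵀ
    refine ⟨posSemidef_diagonal_iff.1 hpsd d, ?_⟩
    have := posSemidef_diagonal_iff.1 hpsd1 d
    exact sub_nonneg.1 this
  -- unit columns
  have hv : ∀ d : Fin r, (fun i => O i d) ⬝ᵥ (fun i => O i d) ≤ 1 := fun d => by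
    have hdd := congrFun (congrFun hO d) d
    rw [mul_apply, one_apply_eq] at hdd
    have : (fun i => O i d) ⬝ᵥ (fun i => O i d) = ∑ i, Oᵀ d i * O i d := by
      simp only [dotProduct, transpose_apply]
    rw [this, hdd]
  have hX' : ∀ U, X U = ∑ d, x U d • vecMulVec (fun i => O i d) (fun i => O i d) := fun U => by
    rw [hX U, conj_diagonal_eq_sum_vecMulVec]
  have hval := value_le_of_cutDictionary W γ h1 (fun d i => O i d) hv x hx01 X Y hX' (fun M => h.2.1 M)
    (fun U M hUM => by rw [h.2.2 U M hUM, trace_zero])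
  rw [div_le_iff₀ hr']
  calc ∑ U, ∑ M, W U M * (X U * Y M).trace ≤ Fintype.card (Fin r) * γ := hval
    _ = γ * r := by rw [Fintype.card_fin, mul_comm]

/-! ### §3 In the crux's currency, modulo Keevash–Lifshitz Thm 1.8 -/

/-- Rate bookkeeping: `L ≤ r·e^{aD}` and `value ≤ L·e^{−2aD}` give `value ≤ r·e^{−aD}`. -/
theorem card_mul_exp_le {L r a D : ℝ} (hL : L ≤ r * Real.exp (a * D)) :
    L * Real.exp (-(2 * a * D)) ≤ r * Real.exp (-(a * D)) := by
  calc L * Real.exp (-(2 * a * D)) ≤ r * Real.exp (a * D) * Real.exp (-(2 * a * D)) :=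
        mul_le_mul_of_nonneg_right hL (Real.exp_nonneg _)
    _ = r * Real.exp (-(a * D)) := by
        rw [mul_assoc, ← Real.exp_add]; congr 2; ring

/-- **The crux on cut sides of bounded DIRECTIONAL ENTROPY, modulo KL Thm 1.8.** For some `a > 0` and all large even `n`: for every balanced
`B = 20` design of degree `dq n`, every dimension `r ≥ 1`, every dictionary `v : ι → ℝ^r` (`‖v_d‖² ≤ 1`) of size `|ι| ≤ r·exp(a·dq n)` and
every tight-orthogonal psd rectangle `(X, Y)` of dimension `r` with `X_U = Σ_d λ_U(d)·v_d v_dᵀ` (`0 ≤ λ ≤ 1`):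
`value/r ≤ exp(−a·dq n)`. No condition `r² n < exp(a·dq n)`. [cite: KeevashLifshitz2023, Thm. 1.8] [cite: Rothvoss2017, §2 (PDF pp. 6–8)] -/
theorem tracialDecayExp_cutDictionary_of_globalLevelD (hKL : GlobalLevelDInequality) :
    ∃ a : ℝ, 0 < a ∧ ∃ n₁ : ℕ, ∀ n : ℕ, n₁ ≤ n → Even n → ∀ (t : ℕ) (C : Finset ℕ) (w : ℕ → ℝ),
      IsBalancedDesign n t (Tq n) (dq n) 20 C w → ∀ (r : ℕ), 0 < r → ∀ (ι : Type) [Fintype ι],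
        (Fintype.card ι : ℝ) ≤ r * Real.exp (a * (dq n : ℝ)) →
        ∀ (v : ι → Fin r → ℝ), (∀ d, v d ⬝ᵥ v d ≤ 1) → ∀ (lam : OddSet n → ι → ℝ), (∀ U d, 0 ≤ lam U d ∧ lam U d ≤ 1) →
        ∀ (X : OddSet n → Matrix (Fin r) (Fin r) ℝ) (Y : PMatch n → Matrix (Fin r) (Fin r) ℝ), IsPsdRect X Y →
          (∀ U, X U = ∑ d, lam U d • vecMulVec (v d) (v d)) →
            (∑ U, ∑ M, levelWeight n t C w U M * (X U * Y M).trace) / r ≤ Real.exp (-(a * (dq n : ℝ))) := by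
  obtain ⟨a₀, ha₀, n₁, h⟩ := rectangleDecayExp_of_globalLevelD hKL
  refine ⟨a₀ / 2, by positivity, n₁, fun n hn hev t C w hdes r hr ι _ hcard v hv lam hlam X Y hXY hX => ?_⟩
  have hr' : (0 : ℝ) < r := by exact_mod_cast hr
  have h1 : TracialValueLEAt (levelWeight n t C w) (Real.exp (-(a₀ * (dq n : ℝ)))) 1 :=
    (tracialValueLEAt_one_iff _ _).2 (h n hn hev t C w hdes)
  have hval := value_le_of_cutDictionary (levelWeight n t C w) _ h1 v hv lam hlam X Y hX (fun M => hXY.2.1 M)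
    (fun U M hUM => by rw [hXY.2.2 U M hUM, trace_zero])
  rw [div_le_iff₀ hr']
  have e2 : a₀ * (dq n : ℝ) = 2 * (a₀ / 2) * (dq n : ℝ) := by ring
  rw [e2] at hval
  calc ∑ U, ∑ M, levelWeight n t C w U M * (X U * Y M).trace
      ≤ Fintype.card ι * Real.exp (-(2 * (a₀ / 2) * (dq n : ℝ))) := hval
    _ ≤ r * Real.exp (-(a₀ / 2 * (dq n : ℝ))) := card_mul_exp_le hcard
    _ = Real.exp (-(a₀ / 2 * (dq n : ℝ))) * r := mul_comm _ _

/-- **The crux on cut sides with few distinct values, modulo KL Thm 1.8.** For some `a > 0` and all large even `n`: every balanced `B = 20`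
design has normalised value `≤ exp(−a·dq n)` on every tight-orthogonal psd rectangle of any dimension `r ≥ 1` whose cut side `X = P ∘ κ`
takes at most `exp(a·dq n)` distinct values (the values `P_c` need not commute). [cite: KeevashLifshitz2023, Thm. 1.8]
[cite: Rothvoss2017, §2 (PDF pp. 6–8)] -/
theorem tracialDecayExp_cutFiniteValued_of_globalLevelD (hKL : GlobalLevelDInequality) :
    ∃ a : ℝ, 0 < a ∧ ∃ n₁ : ℕ, ∀ n : ℕ, n₁ ≤ n → Even n → ∀ (t : ℕ) (C : Finset ℕ) (w : ℕ → ℝ),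
      IsBalancedDesign n t (Tq n) (dq n) 20 C w → ∀ (r : ℕ), 0 < r → ∀ (ι : Type) [Fintype ι],
        (Fintype.card ι : ℝ) ≤ Real.exp (a * (dq n : ℝ)) → ∀ (κ : OddSet n → ι) (P : ι → Matrix (Fin r) (Fin r) ℝ)
        (X : OddSet n → Matrix (Fin r) (Fin r) ℝ) (Y : PMatch n → Matrix (Fin r) (Fin r) ℝ), IsPsdRect X Y →
          (∀ U, X U = P (κ U)) →
            (∑ U, ∑ M, levelWeight n t C w U M * (X U * Y M).trace) / r ≤ Real.exp (-(a * (dq n : ℝ))) := by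
  obtain ⟨a₀, ha₀, n₁, h⟩ := rectangleDecayExp_of_globalLevelD hKL
  refine ⟨a₀ / 2, by positivity, n₁, fun n hn hev t C w hdes r hr ι _ hcard κ P X Y hXY hX => ?_⟩
  have h1 : TracialValueLEAt (levelWeight n t C w) (Real.exp (-(a₀ * (dq n : ℝ)))) 1 :=
    (tracialValueLEAt_one_iff _ _).2 (h n hn hev t C w hdes)
  have hval := value_div_le_of_cutFiniteValued hr (levelWeight n t C w) _ h1 κ P hXY hX
  have e2 : a₀ * (dq n : ℝ) = 2 * (a₀ / 2) * (dq n : ℝ) := by ring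
  rw [e2] at hval
  calc (∑ U, ∑ M, levelWeight n t C w U M * (X U * Y M).trace) / r
      ≤ Fintype.card ι * Real.exp (-(2 * (a₀ / 2) * (dq n : ℝ))) := hval
    _ ≤ 1 * Real.exp (-(a₀ / 2 * (dq n : ℝ))) := card_mul_exp_le (by rwa [one_mul])
    _ = Real.exp (-(a₀ / 2 * (dq n : ℝ))) := one_mul _

/-- **The crux when only the cut side is commutative, modulo KL Thm 1.8.** For some `a > 0` and all large even `n`: every balanced `B = 20`
design has normalised value `≤ exp(−a·dq n)` on every tight-orthogonal psd rectangle of any dimension `r ≥ 1` whose CUT side has a common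
orthonormal eigenbasis (`X_U = O·diag(x_U)·Oᵀ`), whatever the matching side; rate of the `r = 1` rung, no dimension budget.
[cite: KeevashLifshitz2023, Thm. 1.8] [cite: Rothvoss2017, §2 (PDF pp. 6–7)] -/
theorem tracialDecayExp_cutEigenbasis_of_globalLevelD (hKL : GlobalLevelDInequality) :
    ∃ a : ℝ, 0 < a ∧ ∃ n₁ : ℕ, ∀ n : ℕ, n₁ ≤ n → Even n → ∀ (t : ℕ) (C : Finset ℕ) (w : ℕ → ℝ),
      IsBalancedDesign n t (Tq n) (dq n) 20 C w → ∀ (r : ℕ), 0 < r →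
        ∀ (O : Matrix (Fin r) (Fin r) ℝ), Oᵀ * O = 1 → ∀ (x : OddSet n → Fin r → ℝ)
          (X : OddSet n → Matrix (Fin r) (Fin r) ℝ) (Y : PMatch n → Matrix (Fin r) (Fin r) ℝ),
          (∀ U, X U = O * diagonal (x U) * Oᵀ) → IsPsdRect X Y →
            (∑ U, ∑ M, levelWeight n t C w U M * (X U * Y M).trace) / r ≤ Real.exp (-(a * (dq n : ℝ))) := by
  obtain ⟨a₀, ha₀, n₁, h⟩ := rectangleDecayExp_of_globalLevelD hKL
  exact ⟨a₀, ha₀, n₁, fun n hn hev t C w hdes r hr O hO x X Y hX hXY =>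
    value_div_le_of_cutEigenbasis hr (levelWeight n t C w) _ ((tracialValueLEAt_one_iff _ _).2 (h n hn hev t C w hdes))
      O hO x hX hXY⟩

end Summit.PneNP.PneNP.Theorems.ChebyshevTracialDesignDictionary

end
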